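import Summits.HubbardSuperconductivity.HubbardLadder.Bounds.TwistedCouplingDegree
import Literature.MathematicalPhysics.QuantumLattice.HubbardGaugeBound
import HarnessLib

/-!
# Complex seam twists of the `t–t'` Hubbard torus: the complex column gauge and the spreading gauge
# (bounds.tex Theorem 12 (iii), step 1 — LEAN FILING REQUEST #206.1, bounds g27)

HONEST FRAMING (cell pub-hubbard): ladder R1–R4 with certified numbers; no claim on H/H₀. This file
is a BOUND FOR A MODEL CLASS (the seam-twisted `t–t'` Hubbard torus at high temperature, any sign
of `U`, any `μ`); no materials claim.

Part (iii) of bounds.tex Theorem 12 (the curvature `𝒟^F`, i.e. the second and all higher twist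
derivatives of `log Z_L`) needs the twist parameter to be COMPLEX: Cauchy's estimate on a disc. The
Literature Hamiltonian `hubbardTorusTT'Flux L t' U θ` only takes a real seam angle, so the
complexification is done at the level of Ueltschi's generalised Gibbs factor
`Zc β U μ c = Tr exp(-β V_Λ + Σ_b c_b T_b)` (arbitrary complex bond couplings, `HubbardBondAlgebra`):

* `seamPhaseC L θ u v` (`θ : ℂ`): the seam phase `e^{± iθ}` across the seam, `1` elsewhere; for real
  `θ` it is #181.2's `seamPhase` (`seamPhaseC_ofReal`), and `ttFluxCouplingC L β t' θ = ω_θ · c_0` is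
  the complex-twisted coupling (`= ttFluxCoupling L β t' θ` for real `θ`, `ttFluxCouplingC_ofReal`).
* `Zc_siteGauge`, `Zc_cgauge`: invariance of `Zc` under the imaginary-angle site gauge
  `G(φ) = exp[-Σ φ_u n_u]` (Koma–Tasaki, tree `siteGauge`) and hence under every COMPLEX site gauge
  `ζ : Λ → ℂ` acting on the couplings by `c_{(x,y,σ)} ↦ e^{i(ζ_x - ζ_y)} c_{(x,y,σ)}` (unitary part:
  #181.2's `Zc_gauge`; positive part: `Zc_siteGauge`). PROVED.
* `Zc_seamPhaseC_mul_eq` (complex column gauge lemma): for a coupling pattern avoiding column `k`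
  and joining only equal or cyclically adjacent columns, `Zc(ω_θ c) = Zc(c)` for every `θ ∈ ℂ`; hence
  the activities of column-missing polymers are twist-blind for complex twists
  (`siteActivityC_ttFluxCouplingC_twist_blind`, `siteActivityC_twistC_dichotomy`). PROVED.
* `ttSpreadCouplingC` (spreading gauge `ζ_x = θ x₁ / L`): a gauge-equivalent coupling with THE SAME
  activities (`siteActivityC_ttSpreadCouplingC_eq`) whose every bond carries at most the factor
  `e^{|Im θ|/L}` (`norm_ttSpreadCouplingC_le`) — the seam phase spread over all inter-column bonds;
  this makes the Cauchy radius `Lη` (not `η`) available downstream (`∂_A = L∂_θ`, `A = θ/L`).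
References: D. Ueltschi, J. Stat. Phys. 95 (1999) 693, §2.3 [Ueltschi1999]; T. Koma, H. Tasaki, Phys.
Rev. Lett. 68 (1992) 3248, eqs. (5)–(8) [KomaTasakiPRL1992]; bounds.tex §12, Lemma 12.5, Thm 12 (iii).
-/

noncomputable section

namespace Summit.HubbardSuperconductivity.HubbardLadder.Bounds

open Matrix Finset Literature.MathematicalPhysics.QuantumLattice
open scoped ComplexConjugate

/-! ### The imaginary-angle site gauge and the complex gauge (any finite `Λ`) -/
section Gauge

variable {Λ : Type*} [LinearOrder Λ] [Fintype Λ]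

/-- `G(φ) T_{(x,y,σ)} G(φ)⁻¹ = e^{φ_y - φ_x} T_{(x,y,σ)}` for `T_{(x,y,σ)} = c†_{xσ} c_{yσ}`: the bond
operators are eigenvectors of the imaginary-angle gauge conjugation. [cite: KomaTasakiPRL1992, eq. (8)] -/
theorem siteGauge_mul_bondOp_mul (φ : Λ → ℝ) (b : Bond Λ) :
    siteGauge φ * bondOp b * siteGauge (-φ) =
      ((Real.exp (φ b.2.1 - φ b.1) : ℝ) : ℂ) • bondOp b := by
  rw [bondOp, siteGauge_conj_mul, siteGauge_mul_creation_mul, siteGauge_mul_annihilation_mul,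
    smul_mul_smul_comm, ← Complex.ofReal_mul, ← Real.exp_add, show -φ b.1 + φ b.2.1 = φ b.2.1 - φ b.1 by ring]

/-- `G(φ) (Σ_b c_b T_b) G(φ)⁻¹ = Σ_b (e^{φ_{b₂} - φ_{b₁}} c_b) T_b`: the imaginary-angle gauge acts on
the couplings by the positive coboundary. [cite: KomaTasakiPRL1992, eq. (8)] -/
theorem siteGauge_mul_hopSum_mul (φ : Λ → ℝ) (c : Bond Λ → ℂ) :
    siteGauge φ * hopSum c * siteGauge (-φ) =
      hopSum fun b => ((Real.exp (φ b.2.1 - φ b.1) : ℝ) : ℂ) * c b := by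
  simp only [hopSum, Finset.mul_sum, Finset.sum_mul, Matrix.mul_smul, Matrix.smul_mul,
    siteGauge_mul_bondOp_mul, smul_smul]
  refine Finset.sum_congr rfl fun b _ => ?_
  rw [mul_comm (c b)]

/-- The on-site term `U n_{x↑} n_{x↓} - μ (n_{x↑} + n_{x↓})` is invariant under the imaginary-angle
gauge. [cite: KomaTasakiPRL1992, eq. (7)] -/
theorem siteGauge_mul_onSiteOp_mul (φ : Λ → ℝ) (U μ : ℂ) (x : Λ) :
    siteGauge φ * onSiteOp U μ x * siteGauge (-φ) = onSiteOp U μ x := by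
  rw [onSiteOp, Matrix.mul_sub, Matrix.sub_mul, Matrix.mul_smul, Matrix.smul_mul, Matrix.mul_smul,
    Matrix.smul_mul, Matrix.mul_add, Matrix.add_mul, siteGauge_conj_mul]
  simp only [siteGauge_mul_numberOp_mul]

/-- `V_A = Σ_{x ∈ A} V_x` is invariant under the imaginary-angle gauge. [cite: KomaTasakiPRL1992, eq. (7)] -/
theorem siteGauge_mul_onSiteSum_mul (φ : Λ → ℝ) (U μ : ℂ) (A : Finset Λ) :
    siteGauge φ * onSiteSum U μ A * siteGauge (-φ) = onSiteSum U μ A := by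
  simp only [onSiteSum, Finset.mul_sum, Finset.sum_mul, siteGauge_mul_onSiteOp_mul]

/-- **Invariance of Ueltschi's generalised Gibbs factor under the imaginary-angle site gauge**:
`Zc(β,U,μ; b ↦ e^{φ_{b₂} - φ_{b₁}} c_b) = Zc(β,U,μ; c)` for every real site potential `φ` (cyclicity of
the trace; `G(φ)` is invertible, not unitary). [cite: KomaTasakiPRL1992, eqs. (5)–(8); Ueltschi1999, §2.3] -/
theorem Zc_siteGauge (φ : Λ → ℝ) (β U μ : ℂ) (c : Bond Λ → ℂ) :
    Zc β U μ (fun b => ((Real.exp (φ b.2.1 - φ b.1) : ℝ) : ℂ) * c b) = Zc β U μ c := by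
  have hunit : IsUnit (siteGauge φ) := isUnit_siteGauge φ
  have hX : -(β • onSiteSum U μ (Finset.univ : Finset Λ)) +
      hopSum (fun b => ((Real.exp (φ b.2.1 - φ b.1) : ℝ) : ℂ) * c b) =
      siteGauge φ * (-(β • onSiteSum U μ (Finset.univ : Finset Λ)) + hopSum c) * (siteGauge φ)⁻¹ := by
    rw [siteGauge_inv, Matrix.mul_add, Matrix.add_mul, Matrix.mul_neg, Matrix.neg_mul, Matrix.mul_smul,
      Matrix.smul_mul, siteGauge_mul_onSiteSum_mul, siteGauge_mul_hopSum_mul]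
  rw [Zc, Zc, hX, Matrix.exp_conj _ _ hunit, Matrix.trace_mul_cycle, siteGauge_inv,
    siteGauge_neg_mul_siteGauge, Matrix.one_mul]

/-- The complex coboundary factor splits into a `U(1)` coboundary (real parts) and a positive
coboundary (imaginary parts): `e^{i(ζ_u - ζ_v)} = e^{i Re ζ_u} conj(e^{i Re ζ_v}) · e^{Im ζ_v - Im ζ_u}`.
[folklore] -/
theorem cexp_I_mul_sub_eq {ι : Type*} (ζ : ι → ℂ) (u v : ι) :
    Complex.exp (Complex.I * (ζ u - ζ v)) =
      (Circle.exp (ζ u).re : ℂ) * conj (Circle.exp (ζ v).re : ℂ) *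
        ((Real.exp ((ζ v).im - (ζ u).im) : ℝ) : ℂ) := by
  rw [Circle.coe_exp, Circle.coe_exp, ← Complex.exp_conj, map_mul, Complex.conj_ofReal, Complex.conj_I,
    Complex.ofReal_exp, ← Complex.exp_add, ← Complex.exp_add]
  congr 1
  apply Complex.ext
  · simp
  · simp [sub_eq_add_neg]

/-- **Invariance of the generalised Gibbs factor under every complex site gauge**: for `ζ : Λ → ℂ`,
`Zc(β,U,μ; b ↦ e^{i(ζ_{b₁} - ζ_{b₂})} c_b) = Zc(β,U,μ; c)` (complex `β, U, μ`, arbitrary complex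
couplings). Unitary part: #181.2's `Zc_gauge`; positive part: `Zc_siteGauge`. [this file] -/
theorem Zc_cgauge (ζ : Λ → ℂ) (β U μ : ℂ) (c : Bond Λ → ℂ) :
    Zc β U μ (fun b => Complex.exp (Complex.I * (ζ b.1 - ζ b.2.1)) * c b) = Zc β U μ c := by
  calc Zc β U μ (fun b => Complex.exp (Complex.I * (ζ b.1 - ζ b.2.1)) * c b)
      = Zc β U μ (fun b => (Circle.exp (ζ b.1).re : ℂ) * conj (Circle.exp (ζ b.2.1).re : ℂ) *
          (((Real.exp ((fun x => (ζ x).im) b.2.1 - (fun x => (ζ x).im) b.1) : ℝ) : ℂ) * c b)) := by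
        congr 1
        funext b
        rw [cexp_I_mul_sub_eq, mul_assoc]
    _ = Zc β U μ (fun b => ((Real.exp ((fun x => (ζ x).im) b.2.1 - (fun x => (ζ x).im) b.1) : ℝ) : ℂ) * c b) :=
        Zc_gauge (fun x => Circle.exp (ζ x).re) β U μ _
    _ = Zc β U μ c := Zc_siteGauge (fun x => (ζ x).im) β U μ c

end Gauge

/-! ### Complex seam twists of the `t–t'` torus -/
section Torus

variable {L : ℕ} [NeZero L]

variable (L) in
/-- The seam phase of the oriented pair `(u, v)` for a COMPLEX seam angle `θ`: `e^{iθ}` if `u₁ = 0`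
and `v₁ = L-1`, `e^{-iθ}` for the reversed pair, `1` otherwise (#181.2's `seamPhase` for real `θ`).
[programme definition: bounds.tex §12, Definition 12.1 (complex twists)] -/
def seamPhaseC (θ : ℂ) (u v : FermionTorus 2 L) : ℂ :=
  if col u = 0 ∧ col v = L - 1 then Complex.exp (θ * Complex.I)
  else if col u = L - 1 ∧ col v = 0 then Complex.exp (-(θ * Complex.I)) else 1

omit [NeZero L] in
/-- For a real angle the complex seam phase is #181.2's `seamPhase`. [this file] -/
theorem seamPhaseC_ofReal (θ : ℝ) (u v : FermionTorus 2 L) :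
    seamPhaseC L (θ : ℂ) u v = seamPhase L θ u v := rfl

omit [NeZero L] in
/-- At `θ = 0` every seam phase is `1`. [this file] -/
theorem seamPhaseC_zero (u v : FermionTorus 2 L) : seamPhaseC L 0 u v = 1 := by
  unfold seamPhaseC
  split_ifs <;> simp

variable (L) in
/-- **The complex-twisted coupling** of the `t–t'` torus: `c_θ(b) = ω_θ(b) c_0(b)`, `θ ∈ ℂ`
(for real `θ` this is `ttFluxCoupling L β t' θ`, `ttFluxCouplingC_ofReal`). [programme definition:
bounds.tex §12, proof of Thm 12 (iii)] -/
def ttFluxCouplingC (β t' : ℝ) (θ : ℂ) : Bond (FermionTorus 2 L) → ℂ :=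
  fun b => seamPhaseC L θ b.1 b.2.1 * ttFluxCoupling L β t' 0 b

/-- For a real angle the complex-twisted coupling is the twisted coupling of #181.3a (cocycle
`c_θ = ω_θ c_0`, #181.3 `ttFluxCoupling_eq_seamPhase_mul`). [this file] -/
theorem ttFluxCouplingC_ofReal (hL : 3 ≤ L) (β t' θ : ℝ) :
    ttFluxCouplingC L β t' (θ : ℂ) = ttFluxCoupling L β t' θ := by
  funext b
  rw [ttFluxCouplingC, seamPhaseC_ofReal, ← ttFluxCoupling_eq_seamPhase_mul hL]

/-- At `θ = 0` the complex-twisted coupling is the untwisted one. [this file] -/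
theorem ttFluxCouplingC_zero (β t' : ℝ) : ttFluxCouplingC L β t' 0 = ttFluxCoupling L β t' 0 := by
  funext b
  rw [ttFluxCouplingC, seamPhaseC_zero, one_mul]

/-- The complex column-gauge potential for the missing column `k`: `θ` on the columns strictly after
`k` (up to the seam), `0` before. [programme definition: bounds.tex §12, Lemma 12.5] -/
def columnGaugeC (θ : ℂ) (k : ℕ) (u : FermionTorus 2 L) : ℂ :=
  if k < col u then θ else 0

omit [NeZero L] in
/-- **The combinatorial column lemma, complex angles.** On the torus with `L ≥ 3` columns, if `u` and
`v` avoid column `k` and lie in equal or cyclically adjacent columns, the complex column gauge exactly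
absorbs the complex seam phase: `e^{i(ζ_u - ζ_v)} ω_θ(u,v) = 1`. [programme: bounds.tex §12, Lemma 12.5] -/
theorem columnGaugeC_coboundary (hL : 3 ≤ L) (θ : ℂ) {k : ℕ} (hk : k < L) {u v : FermionTorus 2 L}
    (hu : col u ≠ k) (hv : col v ≠ k)
    (hadj : col u = col v ∨ col u = col v + 1 ∨ col v = col u + 1 ∨
      (col u = 0 ∧ col v = L - 1) ∨ (col u = L - 1 ∧ col v = 0)) :
    Complex.exp (Complex.I * (columnGaugeC θ k u - columnGaugeC θ k v)) * seamPhaseC L θ u v = 1 := by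
  have hcu := col_lt u
  have hcv := col_lt v
  unfold columnGaugeC seamPhaseC
  split_ifs <;>
    first
    | omega
    | (simp only [sub_self, mul_zero, Complex.exp_zero, mul_one])
    | (rw [← Complex.exp_add]; convert Complex.exp_zero using 2; ring)

omit [NeZero L] in
/-- **The column gauge lemma for complex twists** (bounds.tex Lemma 12.5 on the strip): for `L ≥ 3`,
every `θ ∈ ℂ`, every column `k < L`, all complex `β, U, μ` and every coupling `c` whose support avoids
column `k` and joins only equal or cyclically adjacent columns, `Zc(β,U,μ; ω_θ · c) = Zc(β,U,μ; c)`.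
[programme: bounds.tex §12, Lemma 12.5; this file] -/
theorem Zc_seamPhaseC_mul_eq (hL : 3 ≤ L) (θ : ℂ) {k : ℕ} (hk : k < L) (β U μ : ℂ)
    (c : Bond (FermionTorus 2 L) → ℂ)
    (hc : ∀ b, c b ≠ 0 → col b.1 ≠ k ∧ col b.2.1 ≠ k ∧
      (col b.1 = col b.2.1 ∨ col b.1 = col b.2.1 + 1 ∨ col b.2.1 = col b.1 + 1 ∨
        (col b.1 = 0 ∧ col b.2.1 = L - 1) ∨ (col b.1 = L - 1 ∧ col b.2.1 = 0))) :
    Zc β U μ (fun b => seamPhaseC L θ b.1 b.2.1 * c b) = Zc β U μ c := by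
  have key : (fun b : Bond (FermionTorus 2 L) =>
      Complex.exp (Complex.I * (columnGaugeC θ k b.1 - columnGaugeC θ k b.2.1)) *
        (seamPhaseC L θ b.1 b.2.1 * c b)) = c := by
    funext b
    by_cases h0 : c b = 0
    · simp [h0]
    · obtain ⟨hu, hv, hadj⟩ := hc b h0
      rw [← mul_assoc, columnGaugeC_coboundary hL θ hk hu hv hadj, one_mul]
  calc Zc β U μ (fun b => seamPhaseC L θ b.1 b.2.1 * c b)
      = Zc β U μ (fun b : Bond (FermionTorus 2 L) =>
          Complex.exp (Complex.I * (columnGaugeC θ k b.1 - columnGaugeC θ k b.2.1)) *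
            (seamPhaseC L θ b.1 b.2.1 * c b)) := (Zc_cgauge _ β U μ _).symm
    _ = Zc β U μ c := by rw [key]

/-- **Twist-blindness of restricted complex-twisted couplings** (any bond predicate avoiding column
`k`): `Zc(c_θ|_keep) = Zc(c_0|_keep)` for every `θ ∈ ℂ`. [programme: bounds.tex §12, Lemma 12.5] -/
theorem Zc_restrict_ttFluxCouplingC_eq (hL : 3 ≤ L) (β t' U μ : ℝ) (θ : ℂ) {k : ℕ} (hk : k < L)
    (keep : Bond (FermionTorus 2 L) → Prop) [DecidablePred keep]
    (hkeep : ∀ b, keep b → col b.1 ≠ k ∧ col b.2.1 ≠ k) :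
    Zc (β : ℂ) (U : ℂ) (μ : ℂ) (fun b => if keep b then ttFluxCouplingC L β t' θ b else 0) =
      Zc (β : ℂ) (U : ℂ) (μ : ℂ) (fun b => if keep b then ttFluxCoupling L β t' 0 b else 0) := by
  have hfac : (fun b => if keep b then ttFluxCouplingC L β t' θ b else 0) =
      fun b => seamPhaseC L θ b.1 b.2.1 * (if keep b then ttFluxCoupling L β t' 0 b else 0) := by
    funext b
    split_ifs
    · rfl
    · rw [mul_zero]
  rw [hfac]
  refine Zc_seamPhaseC_mul_eq hL θ hk _ _ _ _ fun b hb => ?_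
  by_cases hkb : keep b
  · simp only [if_pos hkb] at hb
    exact ⟨(hkeep b hkb).1, (hkeep b hkb).2, ttFluxCoupling_col_adjacent hL β t' 0 b hb⟩
  · simp only [if_neg hkb, ne_eq, not_true_eq_false] at hb

/-- **Twist-blindness of the site activities for complex twists**: for every bond universe `P` and
every site set `A` missing the column `k`, `ρ_θ(A) = ρ_0(A)`, `θ ∈ ℂ`. [this file] -/
theorem siteActivityC_ttFluxCouplingC_twist_blind (hL : 3 ≤ L) (β t' U μ : ℝ) (θ : ℂ) {k : ℕ}
    (hk : k < L) (P : Finset (Bond (FermionTorus 2 L))) {A : Finset (FermionTorus 2 L)}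
    (hA : ∀ x ∈ A, col x ≠ k) :
    siteActivityC P (β : ℂ) (U : ℂ) (μ : ℂ) (ttFluxCouplingC L β t' θ) A =
      siteActivityC P (β : ℂ) (U : ℂ) (μ : ℂ) (ttFluxCoupling L β t' 0) A :=
  siteActivityC_congr_of_Zc P _ _ _ fun K hK =>
    @Zc_restrict_ttFluxCouplingC_eq L _ hL β t' U μ θ k hk (fun b => b ∈ K) (_)
      (fun b hb => ⟨hA _ (hK b hb).1, hA _ (hK b hb).2⟩)

/-- **The twist dichotomy for polymers, complex twists**: every polymer either has the same activity
at twist `θ ∈ ℂ` and at `0`, or has at least `L` sites (it meets every column). [this file] -/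
theorem siteActivityC_twistC_dichotomy (hL : 3 ≤ L) (β t' U μ : ℝ) (θ : ℂ)
    (P : Finset (Bond (FermionTorus 2 L))) (A : Finset (FermionTorus 2 L)) :
    siteActivityC P (β : ℂ) (U : ℂ) (μ : ℂ) (ttFluxCouplingC L β t' θ) A =
        siteActivityC P (β : ℂ) (U : ℂ) (μ : ℂ) (ttFluxCoupling L β t' 0) A ∨ L ≤ A.card := by
  by_cases h : ∀ k < L, ∃ x ∈ A, col x = k
  · exact Or.inr (le_card_of_meets_every_column h)
  · simp only [not_forall, not_exists, not_and, exists_prop] at h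
    obtain ⟨k, hk, hA⟩ := h
    exact Or.inl (siteActivityC_ttFluxCouplingC_twist_blind hL β t' U μ θ hk P hA)

/-! ### The spreading gauge -/
variable (L) in
/-- The spreading gauge potential `ζ_x = θ · x₁ / L` (complex `θ`). [programme definition:
bounds.tex §12, proof of Thm 12 (iii) (seam twist ↔ uniform vector potential `A = θ/L`)] -/
def spreadGaugeC (θ : ℂ) (u : FermionTorus 2 L) : ℂ :=
  θ * (((col u : ℝ) / L : ℝ) : ℂ)

variable (L) in
/-- **The spread coupling**: the complex-twisted coupling transformed by the spreading gauge,
`c^{spr}_θ(x,y,σ) = e^{i(ζ_x - ζ_y)} ω_θ(x,y) c_0(x,y,σ)`; on every bond of the `t–t'` pattern this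
is `e^{± iθ/L} c_0` or `c_0` (uniform vector potential `θ/L`). [programme definition: bounds.tex §12] -/
def ttSpreadCouplingC (β t' : ℝ) (θ : ℂ) : Bond (FermionTorus 2 L) → ℂ :=
  fun b => Complex.exp (Complex.I * (spreadGaugeC L θ b.1 - spreadGaugeC L θ b.2.1)) *
    ttFluxCouplingC L β t' θ b

/-- **The spread coupling is gauge equivalent to the twisted one on every bond set**:
`Zc(c^{spr}_θ|_keep) = Zc(c_θ|_keep)`. [this file, from `Zc_cgauge`] -/
theorem Zc_restrict_ttSpreadCouplingC_eq (β t' : ℝ) (βc U μ : ℂ) (θ : ℂ)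
    (keep : Bond (FermionTorus 2 L) → Prop) [DecidablePred keep] :
    Zc βc U μ (fun b => if keep b then ttSpreadCouplingC L β t' θ b else 0) =
      Zc βc U μ (fun b => if keep b then ttFluxCouplingC L β t' θ b else 0) := by
  have hfac : (fun b => if keep b then ttSpreadCouplingC L β t' θ b else 0) =
      fun b => Complex.exp (Complex.I * (spreadGaugeC L θ b.1 - spreadGaugeC L θ b.2.1)) *
        (if keep b then ttFluxCouplingC L β t' θ b else 0) := by
    funext b
    split_ifs
    · rfl
    · rw [mul_zero]
  rw [hfac]
  exact Zc_cgauge _ _ _ _ _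

/-- **The spread coupling has the same polymer activities as the twisted one** (every `A`, every
bond universe `P`). [this file] -/
theorem siteActivityC_ttSpreadCouplingC_eq (β t' : ℝ) (βc U μ : ℂ) (θ : ℂ)
    (P : Finset (Bond (FermionTorus 2 L))) (A : Finset (FermionTorus 2 L)) :
    siteActivityC P βc U μ (ttSpreadCouplingC L β t' θ) A =
      siteActivityC P βc U μ (ttFluxCouplingC L β t' θ) A :=
  siteActivityC_congr_of_Zc P _ _ _ fun K _ =>
    @Zc_restrict_ttSpreadCouplingC_eq L _ β t' βc U μ θ (fun b => b ∈ K) (_)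

omit [NeZero L] in
/-- The real part of the spreading-gauge exponent: `Re(i(ζ_u - ζ_v)) = Im θ · (v₁ - u₁)/L`. [this file] -/
theorem re_I_mul_spreadGaugeC_sub (θ : ℂ) (u v : FermionTorus 2 L) :
    (Complex.I * (spreadGaugeC L θ u - spreadGaugeC L θ v)).re = θ.im * (((col v : ℝ) - col u) / L) := by
  simp only [spreadGaugeC, Complex.mul_re, Complex.I_re, Complex.I_im, Complex.sub_re, Complex.sub_im,
    Complex.mul_im, Complex.ofReal_re, Complex.ofReal_im, zero_mul, mul_zero, zero_sub, one_mul]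
  ring

omit [NeZero L] in
/-- **The spread phases are `O(e^{|Im θ|/L})`**: on equal or cyclically adjacent columns (`L ≥ 3`),
`|e^{i(ζ_u - ζ_v)} ω_θ(u,v)| ≤ e^{|Im θ|/L}`. [programme: bounds.tex §12, Lemma 12.3 on the strip
(`|c_b(A)| ≤ e^{|Im A|} |c_b(0)|`, `A = θ/L`)] -/
theorem norm_spread_mul_seamPhaseC_le (hL : 3 ≤ L) (θ : ℂ) {u v : FermionTorus 2 L}
    (hadj : col u = col v ∨ col u = col v + 1 ∨ col v = col u + 1 ∨
      (col u = 0 ∧ col v = L - 1) ∨ (col u = L - 1 ∧ col v = 0)) :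
    ‖Complex.exp (Complex.I * (spreadGaugeC L θ u - spreadGaugeC L θ v)) * seamPhaseC L θ u v‖ ≤
      Real.exp (|θ.im| / L) := by
  have hcu := col_lt u
  have hcv := col_lt v
  have hL0 : (0 : ℝ) < L := by exact_mod_cast (show 0 < L by omega)
  have hL1 : ((L - 1 : ℕ) : ℝ) = (L : ℝ) - 1 := by
    rw [Nat.cast_sub (by omega : 1 ≤ L), Nat.cast_one]
  have habs := le_abs_self θ.im
  have hneg := neg_abs_le θ.im
  have hre := re_I_mul_spreadGaugeC_sub (L := L) θ u v
  have hI : (θ * Complex.I).re = -θ.im := by simp [Complex.mul_re]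
  rcases hadj with h | h | h | ⟨h1, h2⟩ | ⟨h1, h2⟩
  · -- same column: both factors have norm `1`
    have hs : seamPhaseC L θ u v = 1 := by
      unfold seamPhaseC; rw [if_neg (by omega), if_neg (by omega)]
    rw [hs, mul_one, Complex.norm_exp, hre, h, sub_self, zero_div, mul_zero, Real.exp_zero]
    exact Real.one_le_exp (div_nonneg (abs_nonneg _) hL0.le)
  · -- `u₁ = v₁ + 1`: factor `e^{-Im θ / L}`
    have hs : seamPhaseC L θ u v = 1 := by
      unfold seamPhaseC; rw [if_neg (by omega), if_neg (by omega)]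
    rw [hs, mul_one, Complex.norm_exp, hre, h]
    push_cast
    refine Real.exp_le_exp.2 ?_
    rw [show θ.im * (((col v : ℝ) - (col v + 1)) / L) = -θ.im / L by ring]
    exact div_le_div_of_nonneg_right (by linarith) hL0.le
  · -- `v₁ = u₁ + 1`: factor `e^{Im θ / L}`
    have hs : seamPhaseC L θ u v = 1 := by
      unfold seamPhaseC; rw [if_neg (by omega), if_neg (by omega)]
    rw [hs, mul_one, Complex.norm_exp, hre, h]
    push_cast
    refine Real.exp_le_exp.2 ?_
    rw [show θ.im * (((col u : ℝ) + 1 - col u) / L) = θ.im / L by ring]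
    exact div_le_div_of_nonneg_right habs hL0.le
  · -- the seam bond: `e^{Im θ (L-1)/L} · e^{-Im θ} = e^{-Im θ / L}`
    have hs : seamPhaseC L θ u v = Complex.exp (θ * Complex.I) := by
      unfold seamPhaseC; rw [if_pos ⟨h1, h2⟩]
    rw [hs, norm_mul, Complex.norm_exp, Complex.norm_exp, hre, hI, h1, h2, hL1, ← Real.exp_add]
    push_cast
    refine Real.exp_le_exp.2 ?_
    rw [show θ.im * (((L : ℝ) - 1 - 0) / L) + -θ.im = -θ.im / L by field_simp; ring]
    exact div_le_div_of_nonneg_right (by linarith) hL0.le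
  · -- the reversed seam bond: `e^{-Im θ (L-1)/L} · e^{Im θ} = e^{Im θ / L}`
    have hs : seamPhaseC L θ u v = Complex.exp (-(θ * Complex.I)) := by
      unfold seamPhaseC; rw [if_neg (by omega), if_pos ⟨h1, h2⟩]
    rw [hs, norm_mul, Complex.norm_exp, Complex.norm_exp, hre, Complex.neg_re, hI, h1, h2, hL1,
      ← Real.exp_add]
    push_cast
    refine Real.exp_le_exp.2 ?_
    rw [show θ.im * ((0 - ((L : ℝ) - 1)) / L) + - -θ.im = θ.im / L by field_simp; ring]
    exact div_le_div_of_nonneg_right habs hL0.le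

/-- **Size of the spread coupling**: `|c^{spr}_θ(b)| ≤ e^{|Im θ|/L} |c_0(b)|` on every bond (`L ≥ 3`).
[programme: bounds.tex §12, Lemma 12.3 on the strip] -/
theorem norm_ttSpreadCouplingC_le (hL : 3 ≤ L) (β t' : ℝ) (θ : ℂ) (b : Bond (FermionTorus 2 L)) :
    ‖ttSpreadCouplingC L β t' θ b‖ ≤ Real.exp (|θ.im| / L) * ‖ttFluxCoupling L β t' 0 b‖ := by
  unfold ttSpreadCouplingC ttFluxCouplingC
  by_cases h0 : ttFluxCoupling L β t' 0 b = 0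
  · simp [h0]
  · rw [← mul_assoc, norm_mul]
    exact mul_le_mul_of_nonneg_right
      (norm_spread_mul_seamPhaseC_le hL θ (ttFluxCoupling_col_adjacent hL β t' 0 b h0)) (norm_nonneg _)

/-- **Size of the spread coupling, explicit**: `|c^{spr}_θ(b)| ≤ e^{|Im θ|/L} |β| (2 + 2|t'|)`.
[programme: bounds.tex §12] -/
theorem norm_ttSpreadCouplingC_le' (hL : 3 ≤ L) (β t' : ℝ) (θ : ℂ) (b : Bond (FermionTorus 2 L)) :
    ‖ttSpreadCouplingC L β t' θ b‖ ≤ Real.exp (|θ.im| / L) * (|β| * (2 + 2 * |t'|)) :=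
  (norm_ttSpreadCouplingC_le hL β t' θ b).trans
    (mul_le_mul_of_nonneg_left (norm_ttFluxCoupling_le hL β t' 0 b) (Real.exp_nonneg _))

/-- **The weighted degree of the spread coupling**: `Σ_{b ∋ v} |c^{spr}_θ(b)| ≤ e^{|Im θ|/L} · 16 |β| (1+|t'|)`
at every site `v`. [programme: bounds.tex §12, Lemma 12.4 on the strip] -/
theorem sum_norm_ttSpreadCouplingC_le (hL : 3 ≤ L) (β t' : ℝ) (θ : ℂ) (v : FermionTorus 2 L)
    (S : Finset (Bond (FermionTorus 2 L))) (hS' : ∀ b ∈ S, v = b.1 ∨ v = b.2.1) :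
    ∑ b ∈ S, ‖ttSpreadCouplingC L β t' θ b‖ ≤ Real.exp (|θ.im| / L) * (16 * (|β| * (1 + |t'|))) := by
  calc ∑ b ∈ S, ‖ttSpreadCouplingC L β t' θ b‖
      ≤ ∑ b ∈ S, Real.exp (|θ.im| / L) * ‖ttFluxCoupling L β t' 0 b‖ :=
        Finset.sum_le_sum fun b _ => norm_ttSpreadCouplingC_le hL β t' θ b
    _ = Real.exp (|θ.im| / L) * ∑ b ∈ S, ‖ttFluxCoupling L β t' 0 b‖ := by rw [Finset.mul_sum]
    _ ≤ Real.exp (|θ.im| / L) * (16 * (|β| * (1 + |t'|))) :=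
        mul_le_mul_of_nonneg_left (sum_norm_ttFluxCoupling_le β t' 0 v S hS') (Real.exp_nonneg _)

end Torus

end Summit.HubbardSuperconductivity.HubbardLadder.Bounds
end
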